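import Summits.CriticalPhenomena.SAWScalingLimit.Theorems.SAWRenewalTightnessEventualTightBoundedExterior

/-!
# `EventualTight`, line `Sketch` v12: the bulk atom at ANY lattice shell shape — rung B and the virginization glue V4

Crux stmt-CriticalPhenomena-1372 (`SAWRenewalTightness.EventualTight`; bulk child `BulkShellTight`, stmt-17588; bulk atom
`VirginArcTraversalTightBounded`, stmt-18042), line `Sketch`, registration v12 (lead c11).

The registered atom X2c₁ᵇ (`stub_virginArcTraversalTightBounded` = item stmt-CriticalPhenomena-18042 verbatim) bounds, uniformly
over bounded finite exteriors of a virgin lattice `N`-disc, the `x_c`-mass of the door-to-door arcs making `k` weak vertex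
traversals of the ONE shell `D(z₀; 2N/5, 3N/5)`.  Thin ⇒ fat monotonicity of weak vertex traversals makes the same statement at a
THICKER shell `D(z₀; ρ₁N, ρ₂N)` (`ρ₁ ≤ 2/5`, `3/5 ≤ ρ₂`) weaker, and nothing in the virginization glue depends on the numbers
`2/5`, `3/5` (lead c7 §1(c): "any fixed aspect, up to constants").  This file carries the atom at an ARBITRARY fixed shape
`0 < ρ₁ < ρ₂ < 1` to the domain level; `…EventualTightAnyShapeGlue.lean` composes it with the arbitrary-aspect reduction
`bulkShellTight_of_bulkShellTightAtAspect` (`…EventualTightShapeReduction.lean`) into `BulkShellTight` and the crux by name.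

* `virginArcTraversalTightReachShape_of_boundedShape` — rung B at shape `(ρ₁, ρ₂)` (bounded finite exteriors ⇒ reach-bounded
  configurations), the proof of `virginArcTraversalTightReach_of_bounded` (`…BoundedExterior.lean`) verbatim;
* `bulkShellTightAtAspect_of_virginArcTraversalTightReachShape` — V4 at shape `(ρ₁, ρ₂)`: the reach-bounded atom gives
  per-shell traversal-count tightness on the interior domain shells `D(y; η, (2ρ₂/ρ₁) η)` with collar `B̄(y, (2/ρ₁) η) ⊆ Ω`
  (cut radius `R_c = (ρ₂+1) η / ρ₁`, so that `ρ₁ R_c = (ρ₂+1) η > η` and `ρ₂ R_c < (2ρ₂/ρ₁) η < R_c < (2/ρ₁) η = R_c + e`,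
  `e = (1-ρ₂) η / ρ₁`); the proof of `bulkShellTightAtAspectTwo_of_virginArcTraversalTightReach` verbatim with these constants.

[cite: DuminilCopinSmirnov2012, §2 (domain Markov property)] [cite: AizenmanBurchardDuke1999, §3.a]
-/

noncomputable section

open MeasureTheory Filter Topology Set Metric
open scoped ENNReal NNReal unitInterval
open Literature.Probability.RandomPlanarGeometry Literature.Probability.LatticeModels

namespace Summit.CriticalPhenomena.SAWScalingLimit.Theorems

/-- **Rung B at an arbitrary shape — X2c₁ᵇ(ρ₁, ρ₂) ⇒ X2c₁ʳ(ρ₁, ρ₂)**: the bounded-finite-exterior atom at the lattice shell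
`D(z₀; ρ₁N, ρ₂N)` gives the same traversal bound for every configuration whose vertices reachable from the door lie within
`C·N` of the centre.  Intersect `Λ` with the closed lattice ball of radius `max(C,1)·N`: finite
(`finite_setOf_dist_toComplex_le`), still virgin, same doors; every arc from `c` stays inside it (its vertices are reachable
from `c`, `SimpleGraph.Walk.takeUntil`), and its arc mass is at most that of `Λ` (`tsum_subtype_mono_of_imp`).  The proof of
`virginArcTraversalTightReach_of_bounded` (`…BoundedExterior.lean`) verbatim — the shell radii are carried along. [folklore] -/
theorem virginArcTraversalTightReachShape_of_boundedShape (ρ₁ ρ₂ : ℝ) :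
    (∀ C θ : ℝ, 0 < θ →
      ∃ (k : ℕ) (N₀ : ℝ), 0 < N₀ ∧
        ∀ (H : SimpleGraph (Site 2)) (Λ : Set (Site 2)) (z₀ : ℂ) (N : ℝ) (u c u' c' : Site 2),
          Λ.Finite → (∀ v ∈ Λ, dist (Site.toComplex v) z₀ ≤ C * N) → N₀ ≤ N →
          (H ≤ zdGraph 2 ∧ (∀ v : Site 2, dist (Site.toComplex v) z₀ ≤ N → v ∈ Λ) ∧
            ∀ v v' : Site 2, dist (Site.toComplex v) z₀ ≤ N + 1 →
              dist (Site.toComplex v') z₀ ≤ N + 1 → (zdGraph 2).Adj v v' → H.Adj v v') →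
          (H.Adj u c ∧ u ∉ Λ ∧ c ∈ Λ ∧ dist (Site.toComplex c) z₀ ≤ N ∧
            N < dist (Site.toComplex u) z₀) →
          (H.Adj u' c' ∧ u' ∉ Λ ∧ c' ∈ Λ ∧ dist (Site.toComplex c') z₀ ≤ N ∧
            N < dist (Site.toComplex u') z₀) →
          ∑' p : {p : {p : H.Walk c c' // p.IsPath ∧ ∀ v ∈ p.support, v ∈ Λ} //
              ∃ ι κ : Fin k → Fin (p.1.support.map Site.toComplex).length, (∀ m, ι m ≤ κ m) ∧
                (∀ m, (dist ((p.1.support.map Site.toComplex).get (ι m)) z₀ ≤ ρ₁ * N ∧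
                    ρ₂ * N ≤ dist ((p.1.support.map Site.toComplex).get (κ m)) z₀) ∨
                  (ρ₂ * N ≤ dist ((p.1.support.map Site.toComplex).get (ι m)) z₀ ∧
                    dist ((p.1.support.map Site.toComplex).get (κ m)) z₀ ≤ ρ₁ * N)) ∧
                ∀ ⦃m m'⦄, m < m' → κ m ≤ ι m'},
              ENNReal.ofReal (SAW.criticalFugacity ^ p.1.1.length) ≤
            ENNReal.ofReal θ *
              ∑' p : {p : H.Walk c c' // p.IsPath ∧ ∀ v ∈ p.support, v ∈ Λ},
                ENNReal.ofReal (SAW.criticalFugacity ^ p.1.length)) →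
    ∀ C θ : ℝ, 0 < θ →
      ∃ (k : ℕ) (N₀ : ℝ), 0 < N₀ ∧
        ∀ (H : SimpleGraph (Site 2)) (Λ : Set (Site 2)) (z₀ : ℂ) (N : ℝ) (u c u' c' : Site 2),
          (∀ v ∈ Λ, H.Reachable c v → dist (Site.toComplex v) z₀ ≤ C * N) → N₀ ≤ N →
          (H ≤ zdGraph 2 ∧ (∀ v : Site 2, dist (Site.toComplex v) z₀ ≤ N → v ∈ Λ) ∧
            ∀ v v' : Site 2, dist (Site.toComplex v) z₀ ≤ N + 1 →
              dist (Site.toComplex v') z₀ ≤ N + 1 → (zdGraph 2).Adj v v' → H.Adj v v') →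
          (H.Adj u c ∧ u ∉ Λ ∧ c ∈ Λ ∧ dist (Site.toComplex c) z₀ ≤ N ∧
            N < dist (Site.toComplex u) z₀) →
          (H.Adj u' c' ∧ u' ∉ Λ ∧ c' ∈ Λ ∧ dist (Site.toComplex c') z₀ ≤ N ∧
            N < dist (Site.toComplex u') z₀) →
          ∑' p : {p : {p : H.Walk c c' // p.IsPath ∧ ∀ v ∈ p.support, v ∈ Λ} //
              ∃ ι κ : Fin k → Fin (p.1.support.map Site.toComplex).length, (∀ m, ι m ≤ κ m) ∧
                (∀ m, (dist ((p.1.support.map Site.toComplex).get (ι m)) z₀ ≤ ρ₁ * N ∧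
                    ρ₂ * N ≤ dist ((p.1.support.map Site.toComplex).get (κ m)) z₀) ∨
                  (ρ₂ * N ≤ dist ((p.1.support.map Site.toComplex).get (ι m)) z₀ ∧
                    dist ((p.1.support.map Site.toComplex).get (κ m)) z₀ ≤ ρ₁ * N)) ∧
                ∀ ⦃m m'⦄, m < m' → κ m ≤ ι m'},
              ENNReal.ofReal (SAW.criticalFugacity ^ p.1.1.length) ≤
            ENNReal.ofReal θ *
              ∑' p : {p : H.Walk c c' // p.IsPath ∧ ∀ v ∈ p.support, v ∈ Λ},
                ENNReal.ofReal (SAW.criticalFugacity ^ p.1.length) := by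
  classical
  intro hX C θ hθ
  obtain ⟨k, N₀, hN₀, hk⟩ := hX (max C 1) θ hθ
  refine ⟨k, N₀, hN₀, fun H Λ z₀ N u c u' c' hreach hN hV hD hD' => ?_⟩
  have hNnn : 0 ≤ N := hN₀.le.trans hN
  have hNle : N ≤ max C 1 * N := le_mul_of_one_le_left hNnn (le_max_right C 1)
  have hCle : C * N ≤ max C 1 * N := mul_le_mul_of_nonneg_right (le_max_left C 1) hNnn
  set Λ' : Set (Site 2) := Λ ∩ {v : Site 2 | dist (Site.toComplex v) z₀ ≤ max C 1 * N} with hΛ'_def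
  have hfin : Λ'.Finite := (finite_setOf_dist_toComplex_le z₀ (max C 1 * N)).subset inter_subset_right
  have hbd : ∀ v ∈ Λ', dist (Site.toComplex v) z₀ ≤ max C 1 * N := fun v hv => hv.2
  have hV' : H ≤ zdGraph 2 ∧ (∀ v : Site 2, dist (Site.toComplex v) z₀ ≤ N → v ∈ Λ') ∧
      ∀ v v' : Site 2, dist (Site.toComplex v) z₀ ≤ N + 1 →
        dist (Site.toComplex v') z₀ ≤ N + 1 → (zdGraph 2).Adj v v' → H.Adj v v' :=
    ⟨hV.1, fun v hv => ⟨hV.2.1 v hv, hv.trans hNle⟩, hV.2.2⟩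
  have hc : c ∈ Λ' := ⟨hD.2.2.1, hD.2.2.2.1.trans hNle⟩
  have hc' : c' ∈ Λ' := ⟨hD'.2.2.1, hD'.2.2.2.1.trans hNle⟩
  have hstep := hk H Λ' z₀ N u c u' c' hfin hbd hN hV'
    ⟨hD.1, fun h => hD.2.1 h.1, hc, hD.2.2.2.1, hD.2.2.2.2⟩
    ⟨hD'.1, fun h => hD'.2.1 h.1, hc', hD'.2.2.2.1, hD'.2.2.2.2⟩
  -- every arc from `c` in `Λ` is an arc in `Λ'` (its vertices are reachable from `c`)
  have harc : ∀ p : H.Walk c c', (p.IsPath ∧ ∀ v ∈ p.support, v ∈ Λ) →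
      (p.IsPath ∧ ∀ v ∈ p.support, v ∈ Λ') := fun p hp =>
    ⟨hp.1, fun v hv => ⟨hp.2 v hv,
      (hreach v (hp.2 v hv) ⟨p.takeUntil v hv⟩).trans hCle⟩⟩
  calc _ ≤ ∑' p : {p : {p : H.Walk c c' // p.IsPath ∧ ∀ v ∈ p.support, v ∈ Λ'} //
              ∃ ι κ : Fin k → Fin (p.1.support.map Site.toComplex).length, (∀ m, ι m ≤ κ m) ∧
                (∀ m, (dist ((p.1.support.map Site.toComplex).get (ι m)) z₀ ≤ ρ₁ * N ∧
                    ρ₂ * N ≤ dist ((p.1.support.map Site.toComplex).get (κ m)) z₀) ∨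
                  (ρ₂ * N ≤ dist ((p.1.support.map Site.toComplex).get (ι m)) z₀ ∧
                    dist ((p.1.support.map Site.toComplex).get (κ m)) z₀ ≤ ρ₁ * N)) ∧
                ∀ ⦃m m'⦄, m < m' → κ m ≤ ι m'},
              ENNReal.ofReal (SAW.criticalFugacity ^ p.1.1.length) :=
        tsum_subtype_subtype_mono_of_imp
          (fun p : H.Walk c c' => ∃ ι κ : Fin k → Fin (p.support.map Site.toComplex).length, (∀ m, ι m ≤ κ m) ∧
            (∀ m, (dist ((p.support.map Site.toComplex).get (ι m)) z₀ ≤ ρ₁ * N ∧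
                ρ₂ * N ≤ dist ((p.support.map Site.toComplex).get (κ m)) z₀) ∨
              (ρ₂ * N ≤ dist ((p.support.map Site.toComplex).get (ι m)) z₀ ∧
                dist ((p.support.map Site.toComplex).get (κ m)) z₀ ≤ ρ₁ * N)) ∧
            ∀ ⦃m m'⦄, m < m' → κ m ≤ ι m')
          (fun p : H.Walk c c' => ENNReal.ofReal (SAW.criticalFugacity ^ p.length)) harc
    _ ≤ ENNReal.ofReal θ *
          ∑' p : {p : H.Walk c c' // p.IsPath ∧ ∀ v ∈ p.support, v ∈ Λ'},
            ENNReal.ofReal (SAW.criticalFugacity ^ p.1.length) := hstep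
    _ ≤ _ := mul_le_mul' le_rfl
        (tsum_subtype_mono_of_imp (fun p : H.Walk c c' => ENNReal.ofReal (SAW.criticalFugacity ^ p.length))
          fun p hp => ⟨hp.1, fun v hv => (hp.2 v hv).1⟩)


/-- **V4 at an arbitrary shape — the virginization glue from the reach-bounded atom at the lattice shell `D(z₀; ρ₁N, ρ₂N)`,
`0 < ρ₁ < ρ₂ < 1`**: per-shell traversal-count tightness on the interior shells `D(y; η, (2ρ₂/ρ₁) η)` of aspect `2ρ₂/ρ₁` whose
collar `B̄(y, (2/ρ₁) η)` lies in `Ω`.  The proof of `bulkShellTightAtAspectTwo_of_virginArcTraversalTightReach`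
(`…BoundedExterior.lean`) verbatim with the constants: cut radius `R_c := (ρ₂+1) η / ρ₁` (so that `ρ₁ R_c = (ρ₂+1) η > η` and
`ρ₂ R_c < (2ρ₂/ρ₁) η < R_c < (2/ρ₁) η`, using `ρ₁ < ρ₂ < 1`), V2 `stub_travTransport` at `(η, ρ₁ R_c, ρ₂ R_c, (2ρ₂/ρ₁) η, R_c)`, V3
`stub_virginConfig` with margin `e := (1-ρ₂) η / ρ₁` (`R_c + e = (2/ρ₁) η`), relative extent `C = max 1 (r/R_c)` (`Ω ⊆ B̄(y, r)`),
V1 `stub_arcMarkov stub_arcFibre`, and the threshold shift `tsum_vertexTraversals_succ_le`.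
[cite: DuminilCopinSmirnov2012, §2 (domain Markov property)] [cite: AizenmanBurchardDuke1999, §3.a] -/
theorem bulkShellTightAtAspect_of_virginArcTraversalTightReachShape :
    ∀ ρ₁ ρ₂ : ℝ, 0 < ρ₁ → ρ₁ < ρ₂ → ρ₂ < 1 →
    (∀ C θ : ℝ, 0 < θ →
      ∃ (k : ℕ) (N₀ : ℝ), 0 < N₀ ∧
        ∀ (H : SimpleGraph (Site 2)) (Λ : Set (Site 2)) (z₀ : ℂ) (N : ℝ) (u c u' c' : Site 2),
          (∀ v ∈ Λ, H.Reachable c v → dist (Site.toComplex v) z₀ ≤ C * N) → N₀ ≤ N →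
          (H ≤ zdGraph 2 ∧ (∀ v : Site 2, dist (Site.toComplex v) z₀ ≤ N → v ∈ Λ) ∧
            ∀ v v' : Site 2, dist (Site.toComplex v) z₀ ≤ N + 1 →
              dist (Site.toComplex v') z₀ ≤ N + 1 → (zdGraph 2).Adj v v' → H.Adj v v') →
          (H.Adj u c ∧ u ∉ Λ ∧ c ∈ Λ ∧ dist (Site.toComplex c) z₀ ≤ N ∧
            N < dist (Site.toComplex u) z₀) →
          (H.Adj u' c' ∧ u' ∉ Λ ∧ c' ∈ Λ ∧ dist (Site.toComplex c') z₀ ≤ N ∧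
            N < dist (Site.toComplex u') z₀) →
          ∑' p : {p : {p : H.Walk c c' // p.IsPath ∧ ∀ v ∈ p.support, v ∈ Λ} //
              ∃ ι κ : Fin k → Fin (p.1.support.map Site.toComplex).length, (∀ m, ι m ≤ κ m) ∧
                (∀ m, (dist ((p.1.support.map Site.toComplex).get (ι m)) z₀ ≤ ρ₁ * N ∧
                    ρ₂ * N ≤ dist ((p.1.support.map Site.toComplex).get (κ m)) z₀) ∨
                  (ρ₂ * N ≤ dist ((p.1.support.map Site.toComplex).get (ι m)) z₀ ∧
                    dist ((p.1.support.map Site.toComplex).get (κ m)) z₀ ≤ ρ₁ * N)) ∧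
                ∀ ⦃m m'⦄, m < m' → κ m ≤ ι m'},
              ENNReal.ofReal (SAW.criticalFugacity ^ p.1.1.length) ≤
            ENNReal.ofReal θ *
              ∑' p : {p : H.Walk c c' // p.IsPath ∧ ∀ v ∈ p.support, v ∈ Λ},
                ENNReal.ofReal (SAW.criticalFugacity ^ p.1.length)) →
    ∀ (D : DobrushinDomain) (a b : ℝ → Site 2), SAW.IsEndpointApprox D a b →
      ∀ (y : ℂ) (η : ℝ), 0 < η → Metric.closedBall y (2 / ρ₁ * η) ⊆ D.carrier →
        ∀ ε : ℝ, 0 < ε → ∃ (j : ℕ) (δ₁ : ℝ), 0 < δ₁ ∧ ∀ δ ∈ Set.Ioc (0 : ℝ) δ₁,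
          SAW.law D.carrier δ (a δ) (b δ)
            {γ | (⟨γ.walk.toCurve (meshPoint δ)⟩ : Curve ℂ).HasTraversals j y η (2 * ρ₂ / ρ₁ * η)} ≤
            ENNReal.ofReal ε := by
  intro ρ₁ ρ₂ hρ₁ hρ₁₂ hρ₂ hX D a b hab y η hη hball ε hε
  -- radii: cut radius `R_c = (ρ₂+1) η / ρ₁`, lattice shell `(ρ₁ R_c, ρ₂ R_c) = (η', R')`, domain shell `(η, 2ρ₂η/ρ₁)`
  have hρ₂0 : 0 < ρ₂ := hρ₁.trans hρ₁₂
  have hu : 0 < η / ρ₁ := div_pos hη hρ₁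
  set R : ℝ := 2 * ρ₂ / ρ₁ * η with hR_def
  set η' : ℝ := (ρ₂ + 1) * η with hη'_def
  set R' : ℝ := ρ₂ * (ρ₂ + 1) / ρ₁ * η with hR'_def
  set Rc : ℝ := (ρ₂ + 1) / ρ₁ * η with hRc_def
  have hR_eq : R = 2 * ρ₂ * (η / ρ₁) := by rw [hR_def]; ring
  have hR'_eq : R' = ρ₂ * (ρ₂ + 1) * (η / ρ₁) := by rw [hR'_def]; ring
  have hRc_eq : Rc = (ρ₂ + 1) * (η / ρ₁) := by rw [hRc_def]; ring
  have hcol_eq : 2 / ρ₁ * η = 2 * (η / ρ₁) := by ring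
  have hηu : η = ρ₁ * (η / ρ₁) := by field_simp
  have hR : 0 < R := by rw [hR_eq]; positivity
  have hηη' : η < η' := by rw [hη'_def]; nlinarith
  have hη'R' : η' < R' := by
    rw [hR'_eq]
    have h1 : η' = (ρ₂ + 1) * (ρ₁ * (η / ρ₁)) := by rw [hη'_def, ← hηu]
    rw [h1]
    have h2 : 0 < (ρ₂ + 1) * (η / ρ₁) := by positivity
    nlinarith
  have hR'R : R' < R := by rw [hR'_eq, hR_eq]; nlinarith
  have hRRc : R < Rc := by rw [hRc_eq, hR_eq]; nlinarith
  have hRc : 0 < Rc := hR.trans hRRc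
  have hRccol : Rc < 2 / ρ₁ * η := by rw [hcol_eq, hRc_eq]; nlinarith
  -- the relative extent of the domain seen from the cut disc
  obtain ⟨r, hr⟩ := (Metric.isBounded_iff_subset_closedBall y).1 D.isBounded
  set C : ℝ := max 1 (r / Rc) with hC_def
  have hC1 : 1 ≤ C := le_max_left _ _
  have hCr : r / Rc ≤ C := le_max_right _ _
  -- X2c₁ʳ, V2, V3
  obtain ⟨k, N₀, hN₀, hXk⟩ := hX C ε hε
  obtain ⟨δ₂, hδ₂, hT'⟩ := stub_travTransport y η η' R' R Rc hη hηη' hη'R' hR'R hRRc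
  have he : 0 < (1 - ρ₂) * (η / ρ₁) := mul_pos (by linarith) hu
  have hball' : Metric.closedBall y (Rc + (1 - ρ₂) * (η / ρ₁)) ⊆ D.carrier := by
    have : Rc + (1 - ρ₂) * (η / ρ₁) = 2 / ρ₁ * η := by rw [hRc_eq, hcol_eq]; ring
    rw [this]; exact hball
  obtain ⟨δ₃, hδ₃, hV'⟩ := stub_virginConfig D y Rc ((1 - ρ₂) * (η / ρ₁)) hRc he hball'
  -- the marked points are outside `B̄(y, 2η/ρ₁)`, so the lattice endpoints leave `B̄(y, R_c)` eventually
  have hout : ∀ i : Fin 2, Rc < dist (D.pt i) y := fun i => by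
    refine lt_of_not_ge fun h => ?_
    have hmem : D.pt i ∈ D.carrier :=
      hball (Metric.mem_closedBall.2 (h.trans hRccol.le))
    have hfr := D.pt_mem_frontier i
    rw [frontier, interior_eq_iff_isOpen.2 D.isOpen] at hfr
    exact hfr.2 hmem
  have hopen : IsOpen {z : ℂ | Rc < dist z y} :=
    isOpen_lt continuous_const (continuous_id.dist continuous_const)
  obtain ⟨δa, hδa, hsubA⟩ := mem_nhdsGT_iff_exists_Ioo_subset.1
    (hab.tendsto_fst.eventually_mem (hopen.mem_nhds (hout 0)))
  obtain ⟨δb, hδb, hsubB⟩ := mem_nhdsGT_iff_exists_Ioo_subset.1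
    (hab.tendsto_snd.eventually_mem (hopen.mem_nhds (hout 1)))
  have hδa0 : (0 : ℝ) < δa := hδa
  have hδb0 : (0 : ℝ) < δb := hδb
  -- the mesh threshold
  refine ⟨k + 1, min (min δ₂ δ₃) (min (min (δa / 2) (δb / 2)) (Rc / N₀)), ?_, fun δ hδ => ?_⟩
  · refine lt_min (lt_min hδ₂ hδ₃) (lt_min (lt_min (half_pos hδa0) (half_pos hδb0)) ?_)
    positivity
  obtain ⟨hδ0, hδle⟩ := hδ
  have hδδ₂ : δ ≤ δ₂ := hδle.trans ((min_le_left _ _).trans (min_le_left _ _))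
  have hδδ₃ : δ ≤ δ₃ := hδle.trans ((min_le_left _ _).trans (min_le_right _ _))
  have hδδa : δ < δa :=
    (hδle.trans ((min_le_right _ _).trans ((min_le_left _ _).trans (min_le_left _ _)))).trans_lt
      (half_lt_self hδa0)
  have hδδb : δ < δb :=
    (hδle.trans ((min_le_right _ _).trans ((min_le_left _ _).trans (min_le_right _ _)))).trans_lt
      (half_lt_self hδb0)
  have hδN₀ : δ ≤ Rc / N₀ := hδle.trans ((min_le_right _ _).trans (min_le_right _ _))
  -- lattice centre, cut radius, the far predicate
  set z₀ : ℂ := (δ : ℂ)⁻¹ * y with hz₀_def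
  set N : ℝ := Rc / δ with hN_def
  have hδC : (δ : ℂ) ≠ 0 := Complex.ofReal_ne_zero.2 hδ0.ne'
  have hz₀ : (δ : ℂ) * z₀ = y := by rw [hz₀_def, ← mul_assoc, mul_inv_cancel₀ hδC, one_mul]
  have hN : δ * N = Rc := by rw [hN_def]; field_simp
  have hNnn : 0 ≤ N := by rw [hN_def]; positivity
  have hN₀N : N₀ ≤ N := by
    rw [hN_def, le_div_iff₀ hδ0]
    calc N₀ * δ ≤ N₀ * (Rc / N₀) := by gcongr
      _ = Rc := by field_simp
  have hdist : ∀ v : Site 2, dist (meshPoint δ v) y = δ * dist (Site.toComplex v) z₀ := fun v => by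
    rw [← hz₀, meshPoint, dist_eq_norm, dist_eq_norm, ← mul_sub, norm_mul, Complex.norm_real,
      Real.norm_of_nonneg hδ0.le]
  -- every mesh vertex of `Ω` is within `C · N` of the lattice centre
  have hmeshC : ∀ v : Site 2, v ∈ meshDomain D.carrier δ → dist (Site.toComplex v) z₀ ≤ C * N := by
    intro v hv
    have hvΩ : meshPoint δ v ∈ D.carrier := (meshDomain_subset_meshVertices _ _ hv)
    have hvr : dist (meshPoint δ v) y ≤ r := Metric.mem_closedBall.1 (hr hvΩ)
    rw [hdist] at hvr
    have h1 : dist (Site.toComplex v) z₀ ≤ r / δ := by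
      rw [le_div_iff₀ hδ0, mul_comm]; exact hvr
    have h2 : r / δ = r / Rc * N := by
      rw [hN_def]; field_simp
    calc dist (Site.toComplex v) z₀ ≤ r / δ := h1
      _ = r / Rc * N := h2
      _ ≤ C * N := mul_le_mul_of_nonneg_right hCr hNnn
  set far : Site 2 → Bool := fun v => decide (N < dist (Site.toComplex v) z₀) with hfar_def
  have hfar_true : ∀ v, far v = true ↔ N < dist (Site.toComplex v) z₀ := fun v => by
    simp [hfar_def]
  have hfar_false : ∀ v, far v = false ↔ dist (Site.toComplex v) z₀ ≤ N := fun v => by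
    simp [hfar_def]
  have hfar_of_mesh : ∀ v : Site 2, Rc < dist (meshPoint δ v) y → far v = true := fun v hv => by
    rw [hfar_true, hN_def, div_lt_iff₀ hδ0, mul_comm]
    rwa [hdist] at hv
  have ha₀ : far (a δ) = true := hfar_of_mesh _ (hsubA ⟨hδ0, hδδa⟩)
  have hb₀ : far (b δ) = true := hfar_of_mesh _ (hsubB ⟨hδ0, hδδb⟩)
  -- V2 and V3 at this mesh
  have hTδ := hT' δ ⟨hδ0, hδδ₂⟩ z₀ N hz₀ hN
  have hVδ := hV' δ ⟨hδ0, hδδ₃⟩ z₀ N hz₀ hN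
  -- the event and the domain-Markov inequality (V1)
  set E : Set (SAW.DomainSAW D.carrier δ (a δ) (b δ)) :=
    {γ | (⟨γ.walk.toCurve (meshPoint δ)⟩ : Curve ℂ).HasTraversals (k + 1) y η R} with hE_def
  have hW : SAW.weight D.carrier δ (a δ) (b δ) E ≤
      ENNReal.ofReal ε * SAW.weight D.carrier δ (a δ) (b δ) Set.univ := by
    refine stub_arcMarkov stub_arcFibre D.carrier δ (a δ) (b δ) far E
      (fun α => ∃ ι κ : Fin (k + 1) → Fin (α.map Site.toComplex).length, (∀ m, ι m ≤ κ m) ∧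
        (∀ m, (dist ((α.map Site.toComplex).get (ι m)) z₀ ≤ η' / δ ∧
            R' / δ ≤ dist ((α.map Site.toComplex).get (κ m)) z₀) ∨
          (R' / δ ≤ dist ((α.map Site.toComplex).get (ι m)) z₀ ∧
            dist ((α.map Site.toComplex).get (κ m)) z₀ ≤ η' / δ)) ∧
        ∀ ⦃m m'⦄, m < m' → κ m ≤ ι m')
      (ENNReal.ofReal ε) ha₀ hb₀ ?_ ?_ ?_
    · -- every walk of `E` enters the closed cut disc
      intro γ hγ
      obtain ⟨v, hv, hvN⟩ := (hTδ D.carrier (a δ) (b δ) γ (k + 1) hγ).1 (Nat.le_add_left 1 k)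
      exact ⟨v, hv, (hfar_false v).2 hvN⟩
    · -- `E` implies `A` on the middle piece
      intro γ hγ β α β' c c' u u' hL hc hc' hu hu' _ _ hβ hβ'
      exact (hTδ D.carrier (a δ) (b δ) γ (k + 1) hγ).2 β α β' c c' u u' hL hc hc' hu hu'
        (fun v hv => (hfar_true v).1 (hβ v hv)) (fun v hv => (hfar_true v).1 (hβ' v hv))
    · -- the arc inequality on every fibre: virgin configuration + doors (V3), reach bound, then X2c₁ʳ, then `k+1 → k`
      intro γ _ β α β' c c' u u' hL hc hc' hu hu' hfc hfc' hβ hβ'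
      obtain ⟨hvirgin, hdoor, hdoor'⟩ := hVδ (a δ) (b δ) γ β α β' c c' u u' hL hc hc' hu hu'
        ((hfar_false c).1 hfc) ((hfar_false c').1 hfc')
        (fun v hv => (hfar_true v).1 (hβ v hv)) (fun v hv => (hfar_true v).1 (hβ' v hv))
      have hreach : ∀ v ∈ {v : Site 2 | v ∉ β ∧ v ∉ β'},
          (discreteDomainGraph D.carrier δ).Reachable c v → dist (Site.toComplex v) z₀ ≤ C * N := by
        intro v _ hcv
        by_cases hvc : v = c
        · subst hvc
          exact (((hfar_false v).1 hfc).trans (le_mul_of_one_le_left hNnn hC1))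
        · obtain ⟨p⟩ := hcv
          obtain ⟨w, hadj, _, _⟩ := p.reverse.exists_eq_cons_of_ne hvc
          exact hmeshC v (discreteDomainGraph_adj_iff.1 hadj).2.1
      have hXthis := hXk (discreteDomainGraph D.carrier δ) {v : Site 2 | v ∉ β ∧ v ∉ β'} z₀ N
        u c u' c' hreach hN₀N hvirgin hdoor hdoor'
      have hNA : ρ₁ * N = η' / δ := by
        rw [hN_def, hη'_def, hRc_def]; field_simp
      have hNB : ρ₂ * N = R' / δ := by
        rw [hN_def, hR'_def, hRc_def]; field_simp
      rw [hNA, hNB] at hXthis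
      exact le_trans (tsum_vertexTraversals_succ_le (discreteDomainGraph D.carrier δ)
        {v : Site 2 | v ∉ β ∧ v ∉ β'} c c' k z₀ (η' / δ) (R' / δ)) hXthis
  -- conclude: `law E = Z⁻¹ · weight E ≤ ε`
  rw [SAW.law_apply_eq_inv_mul_weight]
  calc (SAW.weight D.carrier δ (a δ) (b δ) Set.univ)⁻¹ * SAW.weight D.carrier δ (a δ) (b δ) E
      ≤ (SAW.weight D.carrier δ (a δ) (b δ) Set.univ)⁻¹ *
          (ENNReal.ofReal ε * SAW.weight D.carrier δ (a δ) (b δ) Set.univ) := by gcongr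
    _ = ENNReal.ofReal ε * ((SAW.weight D.carrier δ (a δ) (b δ) Set.univ)⁻¹ *
          SAW.weight D.carrier δ (a δ) (b δ) Set.univ) := by rw [mul_left_comm]
    _ ≤ ENNReal.ofReal ε * 1 := by gcongr; exact ENNReal.inv_mul_le_one _
    _ = ENNReal.ofReal ε := mul_one _

end Summit.CriticalPhenomena.SAWScalingLimit.Theorems

end
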